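import Mathlib

/-!
# Real-analysis pieces of the stage lemma (crux `KhovanskiiApproxType`, stmt-Schanuel-6116, negative lane)

Elementary estimates consumed by `Negative/WithoutKhovanskiiStage.lean`:
`two_rpow_sub_le` (`2^r − 2^s ≤ 3(r − s)` on `[0,1]`), `challenger_dist` (the sup-norm distance from the
challenger `(qα, pα, 2, ρ)` to `θ = (log 2, r log 2, 2, 2^r)`), `expo_bound` (exponent bookkeeping under
the degree condition `C (nq)^{max a 0} ≤ 0.003 n`), `stage_arith` (the final comparison of the two
exponential scales). Mathlib only. [folklore]
-/

noncomputable section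

set_option linter.dupNamespace false

namespace Summit.Schanuel.Schanuel.Cruxes.KhovanskiiApproxType.Negative


/-- `2^r − 2^s ≤ 3 (r − s)` for `0 ≤ s ≤ r ≤ 1` (mean-value bound with `2 log 2 < 3/2`). [folklore] -/
theorem two_rpow_sub_le {s r : ℝ} (hs : 0 ≤ s) (hsr : s ≤ r) (hr : r ≤ 1) :
    (2 : ℝ) ^ r - (2 : ℝ) ^ s ≤ 3 * (r - s) := by
  have hlog2 : Real.log 2 < 7 / 10 := by have := Real.log_two_lt_d9; linarith
  have hlog2pos : 0 < Real.log 2 := Real.log_pos (by norm_num)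
  have hu : (2 : ℝ) ^ s = Real.exp (s * Real.log 2) := by rw [Real.rpow_def_of_pos two_pos, mul_comm]
  have hv : (2 : ℝ) ^ r = Real.exp (r * Real.log 2) := by rw [Real.rpow_def_of_pos two_pos, mul_comm]
  have hvu0 : 0 ≤ (r - s) * Real.log 2 := mul_nonneg (by linarith) hlog2pos.le
  have hvu1 : (r - s) * Real.log 2 ≤ 1 := by
    have h1 : (r - s) * Real.log 2 ≤ (r - s) * 1 :=
      mul_le_mul_of_nonneg_left (by linarith) (by linarith)
    linarith
  rw [hu, hv]
  have hfact : Real.exp (r * Real.log 2) - Real.exp (s * Real.log 2) =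
      Real.exp (s * Real.log 2) * (Real.exp ((r - s) * Real.log 2) - 1) := by
    rw [mul_sub, mul_one, ← Real.exp_add,
      show s * Real.log 2 + (r - s) * Real.log 2 = r * Real.log 2 by ring]
  rw [hfact]
  have he1 : Real.exp ((r - s) * Real.log 2) - 1 ≤ 2 * ((r - s) * Real.log 2) := by
    have h := Real.abs_exp_sub_one_le (x := (r - s) * Real.log 2) (by rw [abs_of_nonneg hvu0]; exact hvu1)
    rw [abs_of_nonneg hvu0] at h
    exact (le_abs_self _).trans h
  have he0 : 0 ≤ Real.exp ((r - s) * Real.log 2) - 1 := by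
    rw [sub_nonneg]; exact Real.one_le_exp hvu0
  have hexpu : Real.exp (s * Real.log 2) ≤ 2 := by
    calc Real.exp (s * Real.log 2) ≤ Real.exp (1 * Real.log 2) :=
          Real.exp_le_exp.mpr (mul_le_mul_of_nonneg_right (by linarith) hlog2pos.le)
      _ = 2 := by rw [one_mul, Real.exp_log two_pos]
  have hprod : (r - s) * Real.log 2 ≤ (r - s) * (7 / 10) :=
    mul_le_mul_of_nonneg_left hlog2.le (by linarith)
  calc Real.exp (s * Real.log 2) * (Real.exp ((r - s) * Real.log 2) - 1)
      ≤ 2 * (2 * ((r - s) * Real.log 2)) := mul_le_mul hexpu he1 he0 (by norm_num)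
    _ ≤ 3 * (r - s) := by linarith

/-- The sup-norm distance from the challenger `(qα, pα, 2, ρ)` to `θ = (log 2, r log 2, 2, 2^r)`. -/
theorem challenger_dist (α ξ : ℂ) (ρ r ε δ : ℝ) (p q : ℕ)
    (hqξ : (q : ℂ) * ξ = ((Real.log 2 : ℝ) : ℂ))
    (hpξ : (p : ℂ) * ξ = (((p : ℝ) / q * Real.log 2 : ℝ) : ℂ))
    (hε : ‖ξ - α‖ = ε) (hε0 : 0 ≤ ε) (hpq : (p : ℝ) ≤ q)
    (hδ : r - p / q = δ) (hδ0 : 0 ≤ δ) (hρ : |ρ - (2 : ℝ) ^ r| ≤ 3 * δ) :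
    ‖Sum.elim ![(q : ℂ) * α, (p : ℂ) * α] ![(2 : ℂ), (ρ : ℂ)] -
      Sum.elim ![((Real.log 2 : ℝ) : ℂ), ((r * Real.log 2 : ℝ) : ℂ)]
        (Complex.exp ∘ ![((Real.log 2 : ℝ) : ℂ), ((r * Real.log 2 : ℝ) : ℂ)])‖ ≤ q * ε + 3 * δ := by
  have hlog2 : Real.log 2 ≤ 1 := by have := Real.log_two_lt_d9; linarith
  have hlog2pos : 0 < Real.log 2 := Real.log_pos (by norm_num)
  have hθ3 : Complex.exp ((Real.log 2 : ℝ) : ℂ) = 2 := by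
    rw [← Complex.ofReal_exp, Real.exp_log two_pos]; push_cast; rfl
  have hθ4 : Complex.exp ((r * Real.log 2 : ℝ) : ℂ) = (((2 : ℝ) ^ r : ℝ) : ℂ) := by
    rw [← Complex.ofReal_exp, Real.rpow_def_of_pos two_pos, mul_comm]
  have hq0 : 0 ≤ (q : ℝ) * ε := by positivity
  have hqε : ‖(q : ℂ) * α - ((Real.log 2 : ℝ) : ℂ)‖ = q * ε := by
    rw [← hqξ, ← mul_sub, norm_mul, Complex.norm_natCast, norm_sub_rev, hε]
  have hpε : ‖(p : ℂ) * α - ((r * Real.log 2 : ℝ) : ℂ)‖ ≤ q * ε + 3 * δ := by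
    have hsplit : (p : ℂ) * α - ((r * Real.log 2 : ℝ) : ℂ) =
        (p : ℂ) * (α - ξ) + ((((p : ℝ) / q * Real.log 2 - r * Real.log 2 : ℝ)) : ℂ) := by
      rw [mul_sub, hpξ]; push_cast; ring
    rw [hsplit]
    refine (norm_add_le _ _).trans ?_
    rw [norm_mul, Complex.norm_natCast, norm_sub_rev, hε, Complex.norm_real, Real.norm_eq_abs]
    have h1 : (p : ℝ) * ε ≤ q * ε := mul_le_mul_of_nonneg_right hpq hε0
    have h2 : |(p : ℝ) / q * Real.log 2 - r * Real.log 2| = δ * Real.log 2 := by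
      rw [abs_sub_comm, show r * Real.log 2 - (p : ℝ) / q * Real.log 2 = δ * Real.log 2 by
        rw [← hδ]; ring, abs_of_nonneg (by positivity)]
    rw [h2]
    have h3 : δ * Real.log 2 ≤ δ * 1 := mul_le_mul_of_nonneg_left hlog2 hδ0
    linarith
  have h3 : ‖(2 : ℂ) - Complex.exp ((Real.log 2 : ℝ) : ℂ)‖ ≤ q * ε + 3 * δ := by
    rw [hθ3, sub_self, norm_zero]; positivity
  have h4 : ‖(ρ : ℂ) - Complex.exp ((r * Real.log 2 : ℝ) : ℂ)‖ ≤ q * ε + 3 * δ := by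
    rw [hθ4, ← Complex.ofReal_sub, Complex.norm_real, Real.norm_eq_abs]
    linarith
  have hqε' : ‖(q : ℂ) * α - ((Real.log 2 : ℝ) : ℂ)‖ ≤ q * ε + 3 * δ := by rw [hqε]; linarith
  refine (pi_norm_le_iff_of_nonneg (by positivity)).mpr ?_
  rintro (i | i) <;> fin_cases i
  · simpa using hqε'
  · simpa using hpε
  · simpa using h3
  · simpa using h4

/-- Exponent bookkeeping of the stage lemma. -/
theorem expo_bound (C n q a b lH lMP : ℝ) (hC : 0 ≤ C) (hn : 1 ≤ n) (hq : 1 ≤ q) (hlH0 : 0 ≤ lH)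
    (hlH : lH ≤ 3 * (n * q) + lMP) (hlMP : 0 ≤ lMP)
    (hdeg : C * (n * q) ^ (max a 0) ≤ 3 / 1000 * n) :
    C * ((n * q) ^ a * lH + (n * q) ^ b) ≤
      3 / 1000 * n * lMP + (9 / 1000 * n ^ 2 * q + C * (n * q) ^ (max b 0)) := by
  have hd1 : (1 : ℝ) ≤ n * q := by nlinarith
  have hna : (n * q) ^ a ≤ (n * q) ^ (max a 0) := Real.rpow_le_rpow_of_exponent_le hd1 (le_max_left _ _)
  have hnb : (n * q) ^ b ≤ (n * q) ^ (max b 0) := Real.rpow_le_rpow_of_exponent_le hd1 (le_max_left _ _)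
  have hna0 : 0 ≤ (n * q) ^ (max a 0) := by positivity
  have h3 : 0 ≤ 3 * (n * q) + lMP := by positivity
  calc C * ((n * q) ^ a * lH + (n * q) ^ b)
      ≤ C * ((n * q) ^ (max a 0) * lH + (n * q) ^ (max b 0)) := by gcongr
    _ ≤ C * ((n * q) ^ (max a 0) * (3 * (n * q) + lMP) + (n * q) ^ (max b 0)) := by gcongr
    _ = C * (n * q) ^ (max a 0) * (3 * (n * q) + lMP) + C * (n * q) ^ (max b 0) := by ring
    _ ≤ 3 / 1000 * n * (3 * (n * q) + lMP) + C * (n * q) ^ (max b 0) := by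
        have := mul_le_mul_of_nonneg_right hdeg h3
        linarith
    _ = 3 / 1000 * n * lMP + (9 / 1000 * n ^ 2 * q + C * (n * q) ^ (max b 0)) := by ring

/-- Final real-analysis step of the stage lemma. -/
theorem stage_arith (n q K1 LMP E1 X ε δ dP : ℝ) (hn : 2 ≤ n) (hq : 2 ≤ q) (hK1 : q + 1 ≤ K1)
    (hLMP0 : 0 ≤ LMP) (hLMPM : LMP ≤ K1 / (6 / 1000)) (hdP : 1 ≤ dP)
    (hE1 : E1 = 3 / 1000 * n * LMP + (K1 - q - 1)) (hX : X ≤ E1)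
    (hkey : Real.exp (-X) ≤ q * ε + 3 * δ) (hε0 : 0 ≤ ε)
    (hdist : ε ≤ Real.exp (-(6 / 1000 * (n * LMP + dP * (K1 / (6 / 1000))))))
    (htail : δ < Real.exp (-(n * K1)) / 6) : False := by
  have hK1pos : 0 < K1 := by linarith
  -- (i)
  have h1 : Real.exp (-E1) ≤ q * ε + 3 * δ := (Real.exp_le_exp.mpr (by linarith)).trans hkey
  -- (ii) ε ≤ exp(-0.006 n LMP - K1)
  have h2 : ε ≤ Real.exp (-(6 / 1000 * n * LMP) - K1) := by
    refine hdist.trans (Real.exp_le_exp.mpr ?_)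
    have : K1 ≤ dP * (K1 / (6 / 1000)) * (6 / 1000) := by
      rw [mul_assoc, div_mul_cancel₀ K1 (by norm_num : (6 / 1000 : ℝ) ≠ 0)]
      nlinarith
    nlinarith
  -- (iii) q ε ≤ exp(-E1)/2
  have h3 : q * ε ≤ Real.exp (-E1) / 2 := by
    have he : (2 : ℝ) ≤ Real.exp 1 := by have := Real.exp_one_gt_d9; linarith
    have hq1 : 2 * q ≤ Real.exp (q + 1) := by
      rw [Real.exp_add]
      have := Real.add_one_le_exp q
      nlinarith [Real.exp_pos q]
    have hmain : 2 * q * Real.exp (-(6 / 1000 * n * LMP) - K1) ≤ Real.exp (-E1) := by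
      have : Real.exp (q + 1) * Real.exp (-(6 / 1000 * n * LMP) - K1) ≤ Real.exp (-E1) := by
        rw [← Real.exp_add, Real.exp_le_exp, hE1]
        nlinarith
      have hpos := Real.exp_pos (-(6 / 1000 * n * LMP) - K1)
      nlinarith
    have hqn : (0:ℝ) ≤ q := by linarith
    nlinarith [mul_le_mul_of_nonneg_left h2 hqn]
  -- (iv) 3 δ < exp(-E1)/2
  have h4 : 3 * δ < Real.exp (-E1) / 2 := by
    have hE1le : E1 ≤ n * K1 := by
      rw [hE1]
      have : 3 / 1000 * n * LMP ≤ 1 / 2 * n * K1 := by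
        have := mul_le_mul_of_nonneg_left hLMPM (by linarith : (0:ℝ) ≤ 3 / 1000 * n)
        have h' : 3 / 1000 * n * (K1 / (6 / 1000)) = 1 / 2 * n * K1 := by ring
        linarith
      nlinarith
    have : Real.exp (-(n * K1)) ≤ Real.exp (-E1) := Real.exp_le_exp.mpr (by linarith)
    linarith
  linarith


end Summit.Schanuel.Schanuel.Cruxes.KhovanskiiApproxType.Negative

end
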